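import Summits.SmoothPoincare4.SmoothPoincare4.Theses.EntropyRung
import Summits.SmoothPoincare4.SmoothPoincare4.Theses.WeylBudget
import Summits.SmoothPoincare4.SmoothPoincare4.Theorems.EntropyRungMargerinRailsDefs
import Summits.SmoothPoincare4.SmoothPoincare4.Theorems.EntropyRungChangGurskyYangStubMargerinPolynomial
import Summits.SmoothPoincare4.SmoothPoincare4.Theorems.EntropyRungChangGurskyYangStubInitialFit
import Summits.SmoothPoincare4.SmoothPoincare4.Theorems.EntropyRungChangGurskyYangStubPinchingPreserved
import Summits.SmoothPoincare4.SmoothPoincare4.Theorems.EntropyRungChangGurskyYangStubPinchedFlowConvergence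
import Summits.SmoothPoincare4.SmoothPoincare4.Theorems.EntropyRungChangGurskyYangStubPathHarnack
import Literature.Geometry.Riemannian.GurskyViaclovskyPath
import Literature.Geometry.Riemannian.GurskyViaclovskyC0Estimate
import Literature.Geometry.Riemannian.GurskyViaclovskyKappaInvariance
import Literature.Geometry.Riemannian.ChangGurskyYangSmoothness
import Literature.Geometry.Riemannian.ChangGurskyYangEuler
import Literature.Geometry.Riemannian.ChernGaussBonnetFour
import Literature.Geometry.Riemannian.ChernGaussBonnetFourProofs
import Literature.Geometry.Riemannian.HamiltonPCOClassificationKillingHopf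
import HarnessLib

/-!
# Line `gv-continuity-path` for crux `EntropyRung.ChangGurskyYang` (item stmt-SmoothPoincare4-10834)

LEAD RESHAPE r2 (same lead, 2026-08-16 ~13:30Z): `stub_pathHarnack` DISCHARGED (LANDED p97575); the four
analytic stubs are each CLOSED MODULO a named fact filed inline by this line and relocated by the gate —
`stub_pathGradient` ⇐ `gurskyViaclovsky_gradientEstimate_weighted_four` (GurskyViaclovskyC1Estimate.lean,
p104676; helper `stub_pathGradient_of_gradientEstimate` p105027), `stub_pathHessian` ⇐
`gurskyViaclovsky_hessianEstimate_weighted_four` (GurskyViaclovskyC2Estimate.lean p99118; helper p100749),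
`stub_pathOpen` ⇐ `gurskyViaclovsky_pathOpen_weighted_four` (GurskyViaclovskyOpenness.lean p102659; helper
p103224), `stub_pathClosed` ⇐ `gurskyViaclovsky_pathClosed_weighted_four` (GurskyViaclovskyClosedness.lean
p102883; helper p103427); `stub_pinchedFlowConvergence` ⇐ `hamilton_convergenceCriterion_four` (p84954).
FIVE sorries remain = five named facts; stub statements unchanged.

LEAD RESHAPE r1 (continuation lead `prover-line-stmt-SmoothPoincare4-10834-c1-0`, 2026-08-16) of the
PLANNER'S SKELETON `Cruxes/ChangGurskyYang/Lines/gv-continuity-path.lean` (crux-plan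
`planner-cruxplan-stmt-SmoothPoincare4-10834-gv-continuity-path-0`; card `Lines/gv-continuity-path.md`;
ideas `gv-continuity-path` ⊕ `gv-weyl-shifted-path`; triage r1-1/2/3 pass ×3).

THE CRUX is VERBATIM the named fact `changGurskyYang_sphere_four` (Chang–Gursky–Yang 2003, Thm. A,
simply connected `scal > 0` case): a closed simply connected 4-manifold carrying a `C^∞` Riemannian
metric with `R > 0` and `∫|W|² dV < 32π²` is diffeomorphic to `S⁴`. CGY §2 reduces it to three leaves:
Chern–Gauss–Bonnet (now a THEOREM of the tree, `chernGaussBonnet_four_holds`), Margerin 1998 Thm. 1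
(now a theorem of the tree MODULO Hamilton 1986 §5.2 — the landed stubs 1–3 of the sister line
`margerin-cone-hamilton-rails`, p84258/p82915/p84218, + `stub_pinchedFlowConvergence` below), and CGY
Thm. 1.4 (`α = 1`) in the connected psc shape (Disproof §7 `Thm14LeafPsc`), which THIS line opens along
the Weyl-weighted Gursky–Viaclovsky continuity path (GV 2003, arXiv:math/0301350, §3–§5, page-read):

  `P_t(h) := σ₂(A_h) − ¼|W_h|² + (1−t)(2−t)R_h²/6 = q·e^{8u}`,  `h = e^{−2u} g`,  `t ∈ [δ, 1]`,

over the tree's vocabulary `Literature.Geometry.Riemannian.GurskyViaclovskyPath.{pathOperator,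
IsPathSolution, Solvable, kappa}` (the planner's four in-file definitions, landed tree-side VERBATIM in
`Literature/Geometry/Riemannian/GurskyViaclovskyPath.lean`; the registered stub texts are unchanged by
the move). WHAT THE RESHAPE DID: (i) `stub_chernGaussBonnet` DISCHARGED (`chernGaussBonnet_four_holds`);
(ii) `stub_pathStart` DISCHARGED (`GurskyViaclovskyPath.exists_pathOperator_pos`,
`ChangGurskyYangSmoothness.lean`); (iii) the κ-constancy along the path, which the planner derived from
CGB, is the tree's CGB-free `IsPathSolution.kappa_eq` (`GurskyViaclovskyKappaInvariance.lean`);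
(iv) `stub_margerin` REPLACED by the sister line's flow stub `stub_pinchedFlowConvergence` (VERBATIM the
registered rails STUB 4, same name and signature; conditional helper p84954 landed) composed with the
landed rails stubs 1–3 and Killing–Hopf (`margerin_of`, kernel-checked); (v) the a-priori package
`stub_pathApriori` OPENED along GV's printed proposition structure into `stub_pathGradient` (GV Prop. 5,
weighted) + `stub_pathHarnack` (the Harnack step of GV Prop. 4, pure Riemannian geometry, HELD BY THE
LEAD) + `stub_pathHessian` (the `C²` part of GV Prop. 6), the sup bound (GV Prop. 3,
`exists_forall_isPathSolution_le`) and the integral lower bound on `max u` (GV Prop. 4,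
`IsPathSolution.exists_log_le`) being theorems of the tree — `pathApriori_of` recomposes the registered
`stub_pathApriori` statement sorry-free; (vi) `stub_pathOpen`, `stub_pathClosed` unchanged.

STUBS (6 registered; `sorry` lives ONLY there): `stub_pinchedFlowConvergence` (Hamilton 1986 §5.2 for
Margerin's pinching sets; shared with the rails line) · `stub_pathGradient` (GV Prop. 5 / Chen 2005
Thm. 1(a)) · `stub_pathHarnack` (GV (Harnack): `max u ≤ min u + C(C₁, g)`) · `stub_pathHessian` (GV
Prop. 6, `C²` part: Guan–Wang 2003 / Li–Li 2003 / Chen 2005 local estimates) · `stub_pathOpen` (GV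
Prop. 2 + implicit function theorem + elliptic regularity) · `stub_pathClosed` (Evans–Krylov + Schauder +
Arzelà–Ascoli).

COMPOSITION (kernel-checked, NO `sorry` below the stubs): `margerin_of` (Margerin's leaf from rails
stubs 1–3 + the flow stub + Killing–Hopf + the classification of free orthogonal quotients of `S⁴`),
`pathApriori_of` (the planner's a-priori statement from sup bound + gradient + Harnack + `exists_log_le` +
Hessian), `thm14Psc_of` (the continuity method: `δ ∈ 𝒮`, `𝒮 ∩ [δ,1]` closed and relatively open below
`1`, hence `1 ∈ 𝒮`, Mathlib's `IsClosed.mem_of_ge_of_forall_exists_gt`; a solution at `t = 1` IS the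
conformal metric with `R > 0`, `¼|W|² < σ₂(A)`), `ChangGurskyYang_of_hypotheses` (CGY §2 p. 121 line
by line from the six stub STATEMENTS), and `ChangGurskyYang_of : ChangGurskyYang` — the crux BY NAME,
`ChangGurskyYang_of_hypotheses` applied to the six registered stubs; `ChangGurskyYang_of_weylBudget`
restates it for the item's second route decl (the same proposition).

DISPROOF USED (`Cruxes/ChangGurskyYang/Disproof.lean`, cdisprove gen 2 v5, re-read 2026-08-16 10:30Z;
`-- Targets`: none registered): §0 `crux_iff_fact`; §3a `changGurskyYang_false_without_compact` (LANDED
`Negative/WithoutCompactFalse`) — honoured: `[CompactSpace M]` is a binder of EVERY stub and is USED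
(sup/min points of `u`, finite volume, uniform `δ`, Fredholm theory, Arzelà–Ascoli, finite diameter in
`stub_pathHarnack`, maximum principles and `T < ∞` in the flow stub); §3b
`changGurskyYang_false_without_simplyConnected` (LANDED `Negative/WithoutSimplyConnectedFalse`) —
honoured: every PDE stub is over connected or arbitrary `M`, `margerin_of` concludes `S⁴ ∨ ℝP⁴`, and
`π₁ = 1` is spent once, in `ChangGurskyYang_of_hypotheses`, to discard `ℝP⁴` (and inside `χ ≥ 2`); §7
`thm14Leaf_false` (PAPER: `hThm14` without connectedness is false on `S⁴ ⊔ S³×S¹`) — honoured: no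
Thm-1.4-shaped stub at all; `thm14Psc_of` proves the `Thm14LeafPsc` shape and CONNECTEDNESS IS USED
exactly in `stub_pathHarnack` (finite Riemannian diameter of a compact connected manifold); §7
`MargerinLeafNonStrict` PAPER-false — honoured: strict `WP < 1/6` from strict `¼|W|² < σ₂(A)`
(`q e^{8u} > 0`); §4/§3d thresholds — `κ > 0` consumed once, as `κ₀ := kappa g` in `pathApriori_of`;
§5 junk — every stub carries `IsRiemannian` (inside `IsPathSolution`); §6/§8 information only.
Negatives index: `ledger negatives --problem SmoothPoincare4` — nothing on this vocabulary.
-/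

noncomputable section

open scoped Manifold ContDiff Topology ENNReal
open Set Filter Module
open Literature.Geometry.Lorentzian (PseudoRiemannianMetric riemannianMeasure)
open Literature.Geometry.Lorentzian.PseudoRiemannianMetric
open Literature.Geometry.Riemannian
open Literature.Geometry.Riemannian.GurskyViaclovskyPath
open Literature.Topology.FourManifolds
open Summit.SmoothPoincare4.SmoothPoincare4.Theses.EntropyRung (ChangGurskyYang)
open Summit.SmoothPoincare4.SmoothPoincare4.Theorems.MargerinRails (pinchingSet)

namespace Summit.SmoothPoincare4.SmoothPoincare4.Cruxes.ChangGurskyYang.GvContinuityPath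

set_option linter.dupNamespace false
set_option linter.unusedVariables false

/-- Local notation: the standard `S⁴ ⊂ ℝ⁵`. -/
local notation "𝕊⁴" => (Metric.sphere (0 : EuclideanSpace ℝ (Fin 5)) 1)

/-! ## The six registered stubs (`sorry` lives ONLY here) -/

/-- **STUB 1 — THE FLOW ENDGAME (VERBATIM the registered STUB 4 `stub_pinchedFlowConvergence` of the
sister line `margerin-cone-hamilton-rails`; Hamilton 1986, criterion 5.2 for Margerin's pinching sets
`pinchingSet m c K τ`; = Margerin 1998 Part VI).** Let `M` be closed connected, `g₀` Riemannian,
`0 < m`, `0 < c < 1/6`, `0 < K`, `0 < τ ≤ 1`, with the Hamilton blocks of every Levi-Civita connection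
of `g₀` in `Z = pinchingSet m c K τ` and such that EVERY Ricci flow of Riemannian metrics on any
`[0, T)` starting at `g₀` keeps its blocks in `Z`. Then `M` carries a `C^∞` Riemannian metric of
constant sectional curvature `k > 0`. CLOSED MODULO the named fact `hamilton_convergenceCriterion_four`
(`stub_pinchedFlowConvergence_of_convergenceCriterion`, LANDED p84954). The hypothesis `m > 0`
excludes the flat torus; connectedness excludes `S⁴ ⊔ S⁴(2)` (no convergence of the normalised
flow). [cite: Hamilton1986, §5, Def. 5.1 and 5.2 (pp. 163–164)]
[cite: Margerin1998, Part VI, Cor. 25, Lemmas 26–27 (pp. 53–57)] [cite: Huisken1985, Thm. 1.1 and §§4–5] -/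
theorem stub_pinchedFlowConvergence :
    ∀ (M : Type) [TopologicalSpace M] [T2Space M] [SecondCountableTopology M]
      [ChartedSpace (EuclideanSpace ℝ (Fin 4)) M] [IsManifold (𝓡 4) ∞ M] [CompactSpace M]
      [ConnectedSpace M]
      (g₀ : PseudoRiemannianMetric (𝓡 4) ∞ (EuclideanSpace ℝ (Fin 4)) (TangentSpace (𝓡 4) : M → Type _))
      (m c K τ : ℝ), g₀.IsRiemannian → 0 < m → 0 < c → c < 1 / 6 → 0 < K → 0 < τ → τ ≤ 1 →
      (∀ (cov : CovariantDerivative (𝓡 4) (EuclideanSpace ℝ (Fin 4)) (TangentSpace (𝓡 4) : M → Type _)),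
        g₀.IsLeviCivita cov →
        ∀ (x : M) (e : Fin 4 → TangentSpace (𝓡 4) x), g₀.IsOrthonormalFrame x e →
          (g₀.blockA cov x e, g₀.blockB cov x e, g₀.blockC cov x e) ∈ pinchingSet m c K τ) →
      (∀ (T : ℝ)
        (g : ℝ → PseudoRiemannianMetric (𝓡 4) ∞ (EuclideanSpace ℝ (Fin 4))
          (TangentSpace (𝓡 4) : M → Type _))
        (cov : ℝ → CovariantDerivative (𝓡 4) (EuclideanSpace ℝ (Fin 4))
          (TangentSpace (𝓡 4) : M → Type _)),
        IsRicciFlow g cov (Ico 0 T) → (∀ t ∈ Ico 0 T, (g t).IsRiemannian) → g 0 = g₀ →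
        ∀ t ∈ Ico 0 T, ∀ (x : M) (e : Fin 4 → TangentSpace (𝓡 4) x),
          (g t).IsOrthonormalFrame x e →
            ((g t).blockA (cov t) x e, (g t).blockB (cov t) x e, (g t).blockC (cov t) x e) ∈
              pinchingSet m c K τ) →
      ∃ (k : ℝ) (g' : PseudoRiemannianMetric (𝓡 4) ∞ (EuclideanSpace ℝ (Fin 4))
          (TangentSpace (𝓡 4) : M → Type _)),
        0 < k ∧ g'.IsRiemannian ∧ g'.HasConstantSectionalCurvature k := by
  sorry

/-- **STUB 2 — THE GRADIENT ESTIMATE ALONG THE WEIGHTED PATH (Gursky–Viaclovsky 2003, Prop. 5: "Let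
`u_t` be a `C³` solution of (path) for some `δ ≤ t ≤ 1` satisfying `u_t < δ̄`. Then
`‖∇u_t‖_{L^∞} < C₁`, where `C₁` depends only upon `δ̄` and `g`" — a maximum-principle computation on
`|∇u|²` in normal coordinates, §4; for the `x`-dependent Weyl weight in the right-hand side the local
`C¹` estimate is S. Chen 2005, Thm. 1(a) + Cor. 2 (general `f(x, u)`), Guan–Wang 2003, Li–Li 2003).**
On a closed `(M⁴, g)`, for a smooth positive right side `q`, `δ ≤ 1` and a level `C₀` there is
`C₁ = C₁(M, g, q, δ, C₀)` with `|∇u|²_g = g.gradSq u ≤ C₁` for every smooth admissible solution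
`(h = e^{−2u} g, u)` at any `t ∈ [δ, 1]` with `u ≤ C₀`. Size XL (three pages of maximum-principle
algebra in normal coordinates; the tree has `MaximumPrincipleAtMaxima.lean`, `hessian`, `gradSq`,
the conformal laws `scalarCurvature_conformal_sq_four`, `weylSchouten_conformal_exp_four`).
[cite: GurskyViaclovsky2003, Prop. 5 (§4)] [cite: Chen2005, Thm. 1(a), Cor. 2]
[cite: GuanWang2003] [cite: LiLi2003] -/
theorem stub_pathGradient :
    ∀ (M : Type) [TopologicalSpace M] [T2Space M] [SecondCountableTopology M]
      [ChartedSpace (EuclideanSpace ℝ (Fin 4)) M] [IsManifold (𝓡 4) ∞ M] [CompactSpace M]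
      (g : PseudoRiemannianMetric (𝓡 4) ∞ (EuclideanSpace ℝ (Fin 4)) (TangentSpace (𝓡 4) : M → Type _))
      [g.HasLeviCivita], g.IsRiemannian →
      ∀ (q : M → ℝ) (δ C₀ : ℝ), ContMDiff (𝓡 4) 𝓘(ℝ) ∞ q → (∀ x, 0 < q x) → δ ≤ 1 →
      ∃ C₁ : ℝ, ∀ t : ℝ, δ ≤ t → t ≤ 1 →
        ∀ (h : PseudoRiemannianMetric (𝓡 4) ∞ (EuclideanSpace ℝ (Fin 4)) (TangentSpace (𝓡 4) : M → Type _))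
          [h.HasLeviCivita] (u : M → ℝ), IsPathSolution g h u t q → (∀ x, u x ≤ C₀) →
          ∀ x, g.gradSq u x ≤ C₁ := by
  sorry

/-- **STUB 3 — THE HARNACK STEP (Gursky–Viaclovsky 2003, proof of Prop. 4, display (Harnack): "The
assumption `|∇u_t| < C₁` implies the Harnack inequality `max u_t ≤ min u_t + C(C₁, g)`, by simply
integrating along a geodesic connecting points at which `u_t` attains its maximum and minimum").**
Pure Riemannian geometry, the one place where CONNECTEDNESS enters (Disproof §7: on `S⁴ ⊔ S³×S¹` it
fails): on a compact connected Riemannian `(M⁴, g)`, for every `C₁` there is `C₂ = C₂(M, g, C₁)` with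
`u x ≤ u y + C₂` for all `x, y` and every smooth `u` with `|∇u|²_g ≤ C₁`. Proof against the tree:
`|u x − u y| ≤ √C₁ · d_g(x, y)` (`ofReal_abs_sub_le_mul_riemEDist` with Cauchy–Schwarz
`abs_mvfderiv_le_sqrt_gradSq_mul_sqrt`), `d_g < ∞` on a connected manifold (`riemEDist_lt_top`) and
`d_g` is continuous, hence bounded on the compact `M × M`. DISCHARGED (reshape r2, 2026-08-16): LANDED
as `Theorems/EntropyRungChangGurskyYangStubPathHarnack.lean` (p97575, with the reusable finite-diameter
lemma `exists_riemEDist_le_of_compact`); this stub is now a one-line call and carries no `sorry`.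
[cite: GurskyViaclovsky2003, proof of Prop. 4, (Harnack)] -/
theorem stub_pathHarnack :
    ∀ (M : Type) [TopologicalSpace M] [T2Space M] [SecondCountableTopology M]
      [ChartedSpace (EuclideanSpace ℝ (Fin 4)) M] [IsManifold (𝓡 4) ∞ M] [CompactSpace M]
      [ConnectedSpace M]
      (g : PseudoRiemannianMetric (𝓡 4) ∞ (EuclideanSpace ℝ (Fin 4)) (TangentSpace (𝓡 4) : M → Type _)),
      g.IsRiemannian → ∀ C₁ : ℝ, ∃ C₂ : ℝ, ∀ u : M → ℝ, ContMDiff (𝓡 4) 𝓘(ℝ) ∞ u →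
        (∀ x, g.gradSq u x ≤ C₁) → ∀ x y, u x ≤ u y + C₂ :=
  -- LANDED (worker W1, p97575): Theorems/EntropyRungChangGurskyYangStubPathHarnack.lean
  Summit.SmoothPoincare4.SmoothPoincare4.Theorems.GvContinuityPath.stub_pathHarnack

/-- **STUB 4 — THE `C²` ESTIMATE ALONG THE WEIGHTED PATH (Gursky–Viaclovsky 2003, Prop. 6, `C²` part:
"Let `u_t` be a `C⁴` solution of (path) for some `δ ≤ t ≤ 1` satisfying `δ̲ < u_t < δ̄`, and
`‖∇u_t‖_{L^∞} < C₁` … The `C²` estimate follows from the global estimates in [GVNegative], or the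
local estimates [GuanWang1] and [LiLi2] … the main fact used … is that `σ₂^{1/2}(A^t)` is a concave
function of the second derivative variables"; for the `x`-dependent weight, S. Chen 2005, Thm. 1(a)).**
On a closed `(M⁴, g)`, for a smooth positive `q`, `δ ≤ 1` and levels `C₀`, `C₁` there is
`C₂ = C₂(M, g, q, δ, C₀, C₁)` with `|∇²u|²_g = g.normSq (g.hessian u) ≤ C₂` for every smooth
admissible solution at any `t ∈ [δ, 1]` with `|u| ≤ C₀` and `|∇u|²_g ≤ C₁`. Size XL (interior `C²`
theory for concave fully nonlinear equations; nothing in the tree or Mathlib). The `C^{2,α}` half of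
Prop. 6 (Evans–Krylov) lives in `stub_pathClosed`. [cite: GurskyViaclovsky2003, Prop. 6 (§5)]
[cite: GuanWang2003] [cite: LiLi2003] [cite: Chen2005, Thm. 1(a)] -/
theorem stub_pathHessian :
    ∀ (M : Type) [TopologicalSpace M] [T2Space M] [SecondCountableTopology M]
      [ChartedSpace (EuclideanSpace ℝ (Fin 4)) M] [IsManifold (𝓡 4) ∞ M] [CompactSpace M]
      (g : PseudoRiemannianMetric (𝓡 4) ∞ (EuclideanSpace ℝ (Fin 4)) (TangentSpace (𝓡 4) : M → Type _))
      [g.HasLeviCivita], g.IsRiemannian →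
      ∀ (q : M → ℝ) (δ C₀ C₁ : ℝ), ContMDiff (𝓡 4) 𝓘(ℝ) ∞ q → (∀ x, 0 < q x) → δ ≤ 1 →
      ∃ C₂ : ℝ, ∀ t : ℝ, δ ≤ t → t ≤ 1 →
        ∀ (h : PseudoRiemannianMetric (𝓡 4) ∞ (EuclideanSpace ℝ (Fin 4)) (TangentSpace (𝓡 4) : M → Type _))
          [h.HasLeviCivita] (u : M → ℝ), IsPathSolution g h u t q →
          (∀ x, |u x| ≤ C₀) → (∀ x, g.gradSq u x ≤ C₁) →
          ∀ x, g.normSq x (g.hessian u x) ≤ C₂ := by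
  sorry

/-- **STUB 5 — OPENNESS of the solvable set below `t = 1` (Gursky–Viaclovsky 2003, Prop. 2 + §5:
"From Proposition (linvert), the linearized operator at `u_t`, `𝓛^t : C^{2,α}(M) → C^α(M)`, is
invertible. The implicit function theorem (see [GT]) implies that `𝒮` is open … since `f ∈ C^∞(M)`,
it follows from classical elliptic regularity theory that `u_t ∈ C^∞(M)`"; with the Weyl weight the
zeroth-order coefficient of the linearisation is `−∂_u(ψ_W + (q/4)e^{4u})^{1/2} < 0` — the
`u`-independent weight drops out — so invertibility is untouched, GV p. 4: "the choice of the right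
hand side in (PDE) is quite flexible; the key requirement is simply that the exponent is a positive
multiple of `u`").** Statement VERBATIM the planner's registered stub. Size L–XL (Hölder spaces and
Schauder theory on a closed manifold are not in the tree; the Banach IFT is Mathlib's).
[cite: GurskyViaclovsky2003, Prop. 2 and §5] -/
theorem stub_pathOpen :
    ∀ (M : Type) [TopologicalSpace M] [T2Space M] [SecondCountableTopology M]
      [ChartedSpace (EuclideanSpace ℝ (Fin 4)) M] [IsManifold (𝓡 4) ∞ M] [CompactSpace M]
      [ConnectedSpace M]
      (g : PseudoRiemannianMetric (𝓡 4) ∞ (EuclideanSpace ℝ (Fin 4)) (TangentSpace (𝓡 4) : M → Type _))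
      [g.HasLeviCivita], g.IsRiemannian →
      ∀ (q : M → ℝ), ContMDiff (𝓡 4) 𝓘(ℝ) ∞ q → (∀ x, 0 < q x) →
      ∀ t₀ : ℝ, t₀ ≤ 1 → Solvable g t₀ q →
        ∃ ε : ℝ, 0 < ε ∧ ∀ t : ℝ, t₀ - ε < t → t < t₀ + ε → t ≤ 1 → Solvable g t q := by
  sorry

/-- **STUB 6 — CLOSEDNESS, i.e. compactness of the solution space from `C²` bounds (Gursky–Viaclovsky
2003, Prop. 6 and §5: "Since `f(x) > 0`, the `C²` estimate implies uniform ellipticity, and the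
`C^{2,α}` estimate then follows from the work of [Krylov] and [Evans] on concave, uniformly elliptic
equations … Proposition (C2estimate) then implies that `𝒮` is closed"):** along `t_k → t`
(`t_k ≤ 1`), smooth admissible solutions with `|u_k|, |∇u_k|²_g, |∇²u_k|²_g ≤ C` have a smooth
admissible solution at `t` in their closure (Evans–Krylov `C^{2,α}` bounds, Schauder bootstrap,
Arzelà–Ascoli, `h = e^{−2u}g` with its Levi-Civita connection solves at `t`; admissibility of the
limit: `σ₂ > 0` forces `σ₁ = lim σ₁ ≥ 0` to be `> 0`, i.e. `R_h > 0`). Statement VERBATIM the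
planner's registered stub. Size L–XL (Evans–Krylov–Schauder theory absent from Mathlib).
[cite: GurskyViaclovsky2003, Prop. 6 and §5] [cite: Evans1982] [cite: Krylov1984] -/
theorem stub_pathClosed :
    ∀ (M : Type) [TopologicalSpace M] [T2Space M] [SecondCountableTopology M]
      [ChartedSpace (EuclideanSpace ℝ (Fin 4)) M] [IsManifold (𝓡 4) ∞ M] [CompactSpace M]
      [ConnectedSpace M]
      (g : PseudoRiemannianMetric (𝓡 4) ∞ (EuclideanSpace ℝ (Fin 4)) (TangentSpace (𝓡 4) : M → Type _))
      [g.HasLeviCivita], g.IsRiemannian →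
      ∀ (q : M → ℝ) (C : ℝ), ContMDiff (𝓡 4) 𝓘(ℝ) ∞ q → (∀ x, 0 < q x) →
      ∀ (s : ℕ → ℝ) (t : ℝ), Tendsto s atTop (𝓝 t) → (∀ k, s k ≤ 1) →
        (∀ k, ∃ (h : PseudoRiemannianMetric (𝓡 4) ∞ (EuclideanSpace ℝ (Fin 4)) (TangentSpace (𝓡 4) : M → Type _))
          (_ : h.HasLeviCivita) (u : M → ℝ), IsPathSolution g h u (s k) q ∧
            ∀ x, |u x| ≤ C ∧ g.gradSq u x ≤ C ∧ g.normSq x (g.hessian u x) ≤ C) →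
        Solvable g t q := by
  sorry

/-! ## The compositions (kernel-checked, no `sorry` below this line)

Every glue theorem takes the stub STATEMENTS it consumes as hypotheses (`…_of`), so that the final
`ChangGurskyYang_of_hypotheses` is a sorry-free certificate that the six registered statements jointly
close the crux; `ChangGurskyYang_of` applies it to the stubs. -/

section Composition

/-- **MARGERIN'S LEAF, from the LANDED rails stubs 1–3 and the flow stub** (= `hMargerin` of the tree's
reduction verbatim, incl. `[ConnectedSpace M]` and the disjunction with `ℝP⁴`, honouring Disproof §3b):
on a closed connected 4-manifold, `R > 0` and `WP < 1/6` pointwise give `M ≅ S⁴` or `M` a standard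
`ℝP⁴`. Proof = the rails skeleton's `margerin_of_stubs`, with STUB 1 (`stub_margerinPolynomial`,
p84258), STUB 2 (`stub_initialFit`, p82915), STUB 3 (`stub_pinchingPreserved`, p84218) the landed
Theorems decls: initial fit into `Z = pinchingSet m c K (σ/2)` with Margerin's margin `σ = σ(c)`; every
Ricci flow from `g` stays in `Z` (tensor maximum principle); the flow stub gives constant curvature
`k > 0`; Killing–Hopf (`killingHopf_quotient_four`, PROVED) and the classification of free orthogonal
quotients of `S⁴` (PROVED) finish. [cite: Margerin1998, Thm. 1 (p. 21)]
[cite: Hamilton1986, §5, 5.2 (p. 164)] [cite: Lee2018, Thm. 12.4, Cor. 12.5] -/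
theorem margerin_of
    (h₄ : ∀ (M : Type) [TopologicalSpace M] [T2Space M] [SecondCountableTopology M]
      [ChartedSpace (EuclideanSpace ℝ (Fin 4)) M] [IsManifold (𝓡 4) ∞ M] [CompactSpace M]
      [ConnectedSpace M]
      (g₀ : PseudoRiemannianMetric (𝓡 4) ∞ (EuclideanSpace ℝ (Fin 4)) (TangentSpace (𝓡 4) : M → Type _))
      (m c K τ : ℝ), g₀.IsRiemannian → 0 < m → 0 < c → c < 1 / 6 → 0 < K → 0 < τ → τ ≤ 1 →
      (∀ (cov : CovariantDerivative (𝓡 4) (EuclideanSpace ℝ (Fin 4)) (TangentSpace (𝓡 4) : M → Type _)),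
        g₀.IsLeviCivita cov →
        ∀ (x : M) (e : Fin 4 → TangentSpace (𝓡 4) x), g₀.IsOrthonormalFrame x e →
          (g₀.blockA cov x e, g₀.blockB cov x e, g₀.blockC cov x e) ∈ pinchingSet m c K τ) →
      (∀ (T : ℝ)
        (g : ℝ → PseudoRiemannianMetric (𝓡 4) ∞ (EuclideanSpace ℝ (Fin 4))
          (TangentSpace (𝓡 4) : M → Type _))
        (cov : ℝ → CovariantDerivative (𝓡 4) (EuclideanSpace ℝ (Fin 4))
          (TangentSpace (𝓡 4) : M → Type _)),
        IsRicciFlow g cov (Ico 0 T) → (∀ t ∈ Ico 0 T, (g t).IsRiemannian) → g 0 = g₀ →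
        ∀ t ∈ Ico 0 T, ∀ (x : M) (e : Fin 4 → TangentSpace (𝓡 4) x),
          (g t).IsOrthonormalFrame x e →
            ((g t).blockA (cov t) x e, (g t).blockB (cov t) x e, (g t).blockC (cov t) x e) ∈
              pinchingSet m c K τ) →
      ∃ (k : ℝ) (g' : PseudoRiemannianMetric (𝓡 4) ∞ (EuclideanSpace ℝ (Fin 4))
          (TangentSpace (𝓡 4) : M → Type _)),
        0 < k ∧ g'.IsRiemannian ∧ g'.HasConstantSectionalCurvature k)
    (M : Type) [TopologicalSpace M] [T2Space M] [SecondCountableTopology M]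
    [ChartedSpace (EuclideanSpace ℝ (Fin 4)) M] [IsManifold (𝓡 4) ∞ M] [CompactSpace M]
    [ConnectedSpace M]
    (g : PseudoRiemannianMetric (𝓡 4) ∞ (EuclideanSpace ℝ (Fin 4)) (TangentSpace (𝓡 4) : M → Type _))
    [g.HasLeviCivita] (hg : g.IsRiemannian) (hR : ∀ x, 0 < g.scalarCurvature x)
    (hWP : ∀ x, g.weakPinching x < 1 / 6) :
    Nonempty (M ≃ₘ⟮𝓡 4, 𝓡 4⟯ 𝕊⁴) ∨ IsRealProjectiveSpace 4 M := by
  -- rails STUB 2 (LANDED): initial fit `m, c`, and for each `τ` a `K`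
  obtain ⟨m, c, hm, hc0, hc, hfit⟩ :=
    Summit.SmoothPoincare4.SmoothPoincare4.Theorems.MargerinRails.stub_initialFit M g hg hR hWP
  -- rails STUB 1 (LANDED): the margin `σ = σ(c)`; run with `τ = σ/2 < σ`
  obtain ⟨σ, hσ0, hσ1, hpoly⟩ :=
    Summit.SmoothPoincare4.SmoothPoincare4.Theorems.MargerinRails.stub_margerinPolynomial c hc0.le hc
  have hτ0 : 0 < σ / 2 := by positivity
  have hτσ : σ / 2 < σ := by linarith
  have hτ1 : σ / 2 ≤ 1 := by linarith
  obtain ⟨K, hK, hfitK⟩ := hfit (σ / 2) hτ0.le hτ1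
  -- rails STUB 3 (LANDED): every Ricci flow of Riemannian metrics from `g` stays in `Z`
  have hpres : ∀ (T : ℝ)
      (gt : ℝ → PseudoRiemannianMetric (𝓡 4) ∞ (EuclideanSpace ℝ (Fin 4))
        (TangentSpace (𝓡 4) : M → Type _))
      (cov : ℝ → CovariantDerivative (𝓡 4) (EuclideanSpace ℝ (Fin 4))
        (TangentSpace (𝓡 4) : M → Type _)),
      IsRicciFlow gt cov (Ico 0 T) → (∀ t ∈ Ico 0 T, (gt t).IsRiemannian) → gt 0 = g →
      ∀ t ∈ Ico 0 T, ∀ (x : M) (e : Fin 4 → TangentSpace (𝓡 4) x),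
        (gt t).IsOrthonormalFrame x e →
          ((gt t).blockA (cov t) x e, (gt t).blockB (cov t) x e, (gt t).blockC (cov t) x e) ∈
            pinchingSet m c K (σ / 2) := by
    intro T gt cov hflow hRiem h0 t ht x e he
    have hT : (0 : ℝ) ∈ Ico 0 T := ⟨le_rfl, lt_of_le_of_lt ht.1 ht.2⟩
    have hLC : (gt 0).IsLeviCivita (cov 0) := hflow.isLeviCivita 0 hT
    refine Summit.SmoothPoincare4.SmoothPoincare4.Theorems.MargerinRails.stub_pinchingPreserved
      m c K σ (σ / 2) hm hc0 hc hK hτ0 hτσ hσ1 hpoly M T gt cov hflow hRiem ?_ t ht x e he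
    intro y f hf
    subst h0
    exact hfitK (cov 0) hLC y f hf
  -- the flow stub: a metric of constant sectional curvature `k > 0` on `M`
  obtain ⟨k, g', hk, hg', hconst⟩ := h₄ M g m c K (σ / 2) hg hm hc0 hc hK hτ0 hτ1 hfitK hpres
  -- Killing–Hopf (PROVED) and the classification of free orthogonal quotients of `S⁴` (PROVED)
  obtain ⟨Γ, q, hfree, hq, hsurj, hfib⟩ := killingHopf_quotient_four M k g' hk hg' hconst
  exact nonempty_diffeomorph_or_isRealProjectiveSpace_of_orthogonal_quotient ⟨2, rfl⟩ hfree hq hsurj hfib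

variable {M : Type} [TopologicalSpace M] [T2Space M] [SecondCountableTopology M]
  [ChartedSpace (EuclideanSpace ℝ (Fin 4)) M] [IsManifold (𝓡 4) ∞ M] [CompactSpace M]

/-- **THE A-PRIORI ESTIMATE (the planner's registered `stub_pathApriori`, now a THEOREM modulo the three
analytic stubs it decomposes into; Gursky–Viaclovsky 2003 §5: "Proposition (upper) implies a uniform
upper bound on solutions `u_t` … We may then apply Proposition (C1estimate) to obtain a uniform
gradient bound, and Lemma (C0) then implies a uniform lower bound on `u_t`. Proposition (C2estimate)
then implies …").** On a closed CONNECTED `(M⁴, g)`, for a smooth positive right side `q`, `δ ≤ 1` and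
`κ₀ > 0` there is `C` bounding `|u|`, `|∇u|²_g` and `|∇²u|²_g` for every smooth admissible solution at
any `t ∈ [δ, 1]` with `κ(h) ≥ κ₀`. Proof: sup bound `u ≤ C_s` (GV Prop. 3, tree
`exists_forall_isPathSolution_le`); gradient bound `C₁` (stub); Harnack `u x ≤ u y + C₂` (stub); lower
bound: `log(κ₀/∫q dV_g) ≤ 4 u(x₁)` at some point (GV Prop. 4, tree `IsPathSolution.exists_log_le`), so
`u ≥ log(κ₀/∫q dV_g)/4 − C₂` everywhere; Hessian bound (stub).
[cite: GurskyViaclovsky2003, Props. 3–6 and §5] -/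
theorem pathApriori_of [ConnectedSpace M]
    (hGrad : ∀ (M : Type) [TopologicalSpace M] [T2Space M] [SecondCountableTopology M]
      [ChartedSpace (EuclideanSpace ℝ (Fin 4)) M] [IsManifold (𝓡 4) ∞ M] [CompactSpace M]
      (g : PseudoRiemannianMetric (𝓡 4) ∞ (EuclideanSpace ℝ (Fin 4)) (TangentSpace (𝓡 4) : M → Type _))
      [g.HasLeviCivita], g.IsRiemannian →
      ∀ (q : M → ℝ) (δ C₀ : ℝ), ContMDiff (𝓡 4) 𝓘(ℝ) ∞ q → (∀ x, 0 < q x) → δ ≤ 1 →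
      ∃ C₁ : ℝ, ∀ t : ℝ, δ ≤ t → t ≤ 1 →
        ∀ (h : PseudoRiemannianMetric (𝓡 4) ∞ (EuclideanSpace ℝ (Fin 4)) (TangentSpace (𝓡 4) : M → Type _))
          [h.HasLeviCivita] (u : M → ℝ), IsPathSolution g h u t q → (∀ x, u x ≤ C₀) →
          ∀ x, g.gradSq u x ≤ C₁)
    (hHar : ∀ (M : Type) [TopologicalSpace M] [T2Space M] [SecondCountableTopology M]
      [ChartedSpace (EuclideanSpace ℝ (Fin 4)) M] [IsManifold (𝓡 4) ∞ M] [CompactSpace M]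
      [ConnectedSpace M]
      (g : PseudoRiemannianMetric (𝓡 4) ∞ (EuclideanSpace ℝ (Fin 4)) (TangentSpace (𝓡 4) : M → Type _)),
      g.IsRiemannian → ∀ C₁ : ℝ, ∃ C₂ : ℝ, ∀ u : M → ℝ, ContMDiff (𝓡 4) 𝓘(ℝ) ∞ u →
        (∀ x, g.gradSq u x ≤ C₁) → ∀ x y, u x ≤ u y + C₂)
    (hHess : ∀ (M : Type) [TopologicalSpace M] [T2Space M] [SecondCountableTopology M]
      [ChartedSpace (EuclideanSpace ℝ (Fin 4)) M] [IsManifold (𝓡 4) ∞ M] [CompactSpace M]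
      (g : PseudoRiemannianMetric (𝓡 4) ∞ (EuclideanSpace ℝ (Fin 4)) (TangentSpace (𝓡 4) : M → Type _))
      [g.HasLeviCivita], g.IsRiemannian →
      ∀ (q : M → ℝ) (δ C₀ C₁ : ℝ), ContMDiff (𝓡 4) 𝓘(ℝ) ∞ q → (∀ x, 0 < q x) → δ ≤ 1 →
      ∃ C₂ : ℝ, ∀ t : ℝ, δ ≤ t → t ≤ 1 →
        ∀ (h : PseudoRiemannianMetric (𝓡 4) ∞ (EuclideanSpace ℝ (Fin 4)) (TangentSpace (𝓡 4) : M → Type _))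
          [h.HasLeviCivita] (u : M → ℝ), IsPathSolution g h u t q →
          (∀ x, |u x| ≤ C₀) → (∀ x, g.gradSq u x ≤ C₁) →
          ∀ x, g.normSq x (g.hessian u x) ≤ C₂)
    (g : PseudoRiemannianMetric (𝓡 4) ∞ (EuclideanSpace ℝ (Fin 4)) (TangentSpace (𝓡 4) : M → Type _))
    [g.HasLeviCivita] (hg : g.IsRiemannian)
    (q : M → ℝ) (δ κ₀ : ℝ) (hq : ContMDiff (𝓡 4) 𝓘(ℝ) ∞ q) (hq0 : ∀ x, 0 < q x) (hδ : δ ≤ 1)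
    (hκ₀ : 0 < κ₀) :
    ∃ C : ℝ, ∀ t : ℝ, δ ≤ t → t ≤ 1 →
      ∀ (h : PseudoRiemannianMetric (𝓡 4) ∞ (EuclideanSpace ℝ (Fin 4)) (TangentSpace (𝓡 4) : M → Type _))
        [h.HasLeviCivita] (u : M → ℝ), IsPathSolution g h u t q → κ₀ ≤ kappa h →
        ∀ x, |u x| ≤ C ∧ g.gradSq u x ≤ C ∧ g.normSq x (g.hessian u x) ≤ C := by
  letI : MeasurableSpace M := borel M
  haveI : BorelSpace M := ⟨rfl⟩
  have hqc : Continuous q := hq.continuous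
  -- GV Prop. 3 (tree): the sup bound
  obtain ⟨Cs, hCs⟩ := exists_forall_isPathSolution_le g hqc hq0 δ
  -- GV Prop. 5 (stub): the gradient bound under the sup bound
  obtain ⟨C₁, hC₁⟩ := hGrad M g hg q δ Cs hq hq0 hδ
  -- the Harnack step (stub): oscillation bound under the gradient bound
  obtain ⟨C₂, hC₂⟩ := hHar M g hg C₁
  -- the lower bound constant of GV Prop. 4
  set L : ℝ := Real.log (κ₀ / ∫ y, q y ∂(riemannianMeasure (g.toContMDiffRiemannianMetric hg))) / 4
    - C₂ with hL
  set C₀ : ℝ := max |Cs| |L| with hC₀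
  -- GV Prop. 6, `C²` part (stub)
  obtain ⟨C₃, hC₃⟩ := hHess M g hg q δ C₀ C₁ hq hq0 hδ
  refine ⟨max (max C₀ C₁) C₃, fun t hδt ht1 h _ u hs hκ x ↦ ?_⟩
  have hsup : ∀ y, u y ≤ Cs := hCs t hδt ht1 h u hs
  have hgrad : ∀ y, g.gradSq u y ≤ C₁ := hC₁ t hδt ht1 h u hs hsup
  have hosc : ∀ y z, u y ≤ u z + C₂ := hC₂ u hs.contMDiff hgrad
  -- GV Prop. 4 (tree): `log(κ₀/∫q) ≤ 4 u(x₁)` somewhere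
  obtain ⟨x₁, hx₁⟩ := IsPathSolution.exists_log_le g h hs ht1 hg hqc hq0 hκ₀ hκ
  have hlow : ∀ y, L ≤ u y := fun y ↦ by
    have h1 := hosc x₁ y
    rw [hL]
    linarith
  have habs : ∀ y, |u y| ≤ C₀ := fun y ↦ by
    rw [abs_le]
    constructor
    · have h1 : -|L| ≤ L := neg_abs_le L
      have h2 : |L| ≤ C₀ := le_max_right _ _
      linarith [hlow y]
    · exact ((hsup y).trans (le_abs_self _)).trans (le_max_left _ _)
  have hhess : ∀ y, g.normSq y (g.hessian u y) ≤ C₃ := hC₃ t hδt ht1 h u hs habs hgrad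
  refine ⟨(habs x).trans ((le_max_left _ _).trans (le_max_left _ _)),
    (hgrad x).trans ((le_max_right _ _).trans (le_max_left _ _)), (hhess x).trans (le_max_right _ _)⟩

/-- **THE CONTINUITY METHOD (Gursky–Viaclovsky 2003, §5, with the Weyl weight): CGY THEOREM 1.4 IN THE
PSC SHAPE** — the conclusion is Disproof §7's `Thm14LeafPsc` at `(M, g)`: on a closed CONNECTED `M⁴`,
`R_g > 0` and `¼∫|W|² < ∫σ₂(A)` give a conformal `C^∞` metric with `R > 0` and `¼|W|² < σ₂(A)`
pointwise — from the a-priori statement and the openness / closedness stubs (as hypotheses). With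
`𝒮 = {t | Solvable g t q}`, `q = P_δ(g)`: `δ ∈ 𝒮` (`exists_pathOperator_pos`, `isPathSolution_self`,
PROVED in the tree), `𝒮 ∩ [δ,1]` is closed (a-priori bound with `κ₀ = κ(g)`, constant along solutions
by the tree's `IsPathSolution.kappa_eq`, + closedness) and relatively open below `1` (openness), so
`1 ∈ 𝒮` (`IsClosed.mem_of_ge_of_forall_exists_gt`); a solution at `t = 1` is the conformal metric sought
(`P_1(h) = σ₂(A_h) − ¼|W_h|² = q e^{8u} > 0`). [cite: GurskyViaclovsky2003, §5]
[cite: ChangGurskyYang2003, Thm. 1.4] -/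
theorem thm14Psc_of [ConnectedSpace M]
    (hApr : ∀ (M : Type) [TopologicalSpace M] [T2Space M] [SecondCountableTopology M]
      [ChartedSpace (EuclideanSpace ℝ (Fin 4)) M] [IsManifold (𝓡 4) ∞ M] [CompactSpace M]
      [ConnectedSpace M]
      (g : PseudoRiemannianMetric (𝓡 4) ∞ (EuclideanSpace ℝ (Fin 4)) (TangentSpace (𝓡 4) : M → Type _))
      [g.HasLeviCivita], g.IsRiemannian →
      ∀ (q : M → ℝ) (δ κ₀ : ℝ), ContMDiff (𝓡 4) 𝓘(ℝ) ∞ q → (∀ x, 0 < q x) → δ ≤ 1 → 0 < κ₀ →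
      ∃ C : ℝ, ∀ t : ℝ, δ ≤ t → t ≤ 1 →
        ∀ (h : PseudoRiemannianMetric (𝓡 4) ∞ (EuclideanSpace ℝ (Fin 4)) (TangentSpace (𝓡 4) : M → Type _))
          [h.HasLeviCivita] (u : M → ℝ), IsPathSolution g h u t q → κ₀ ≤ kappa h →
          ∀ x, |u x| ≤ C ∧ g.gradSq u x ≤ C ∧ g.normSq x (g.hessian u x) ≤ C)
    (hOpen : ∀ (M : Type) [TopologicalSpace M] [T2Space M] [SecondCountableTopology M]
      [ChartedSpace (EuclideanSpace ℝ (Fin 4)) M] [IsManifold (𝓡 4) ∞ M] [CompactSpace M]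
      [ConnectedSpace M]
      (g : PseudoRiemannianMetric (𝓡 4) ∞ (EuclideanSpace ℝ (Fin 4)) (TangentSpace (𝓡 4) : M → Type _))
      [g.HasLeviCivita], g.IsRiemannian →
      ∀ (q : M → ℝ), ContMDiff (𝓡 4) 𝓘(ℝ) ∞ q → (∀ x, 0 < q x) →
      ∀ t₀ : ℝ, t₀ ≤ 1 → Solvable g t₀ q →
        ∃ ε : ℝ, 0 < ε ∧ ∀ t : ℝ, t₀ - ε < t → t < t₀ + ε → t ≤ 1 → Solvable g t q)
    (hClosed : ∀ (M : Type) [TopologicalSpace M] [T2Space M] [SecondCountableTopology M]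
      [ChartedSpace (EuclideanSpace ℝ (Fin 4)) M] [IsManifold (𝓡 4) ∞ M] [CompactSpace M]
      [ConnectedSpace M]
      (g : PseudoRiemannianMetric (𝓡 4) ∞ (EuclideanSpace ℝ (Fin 4)) (TangentSpace (𝓡 4) : M → Type _))
      [g.HasLeviCivita], g.IsRiemannian →
      ∀ (q : M → ℝ) (C : ℝ), ContMDiff (𝓡 4) 𝓘(ℝ) ∞ q → (∀ x, 0 < q x) →
      ∀ (s : ℕ → ℝ) (t : ℝ), Tendsto s atTop (𝓝 t) → (∀ k, s k ≤ 1) →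
        (∀ k, ∃ (h : PseudoRiemannianMetric (𝓡 4) ∞ (EuclideanSpace ℝ (Fin 4)) (TangentSpace (𝓡 4) : M → Type _))
          (_ : h.HasLeviCivita) (u : M → ℝ), IsPathSolution g h u (s k) q ∧
            ∀ x, |u x| ≤ C ∧ g.gradSq u x ≤ C ∧ g.normSq x (g.hessian u x) ≤ C) →
        Solvable g t q)
    (g : PseudoRiemannianMetric (𝓡 4) ∞ (EuclideanSpace ℝ (Fin 4)) (TangentSpace (𝓡 4) : M → Type _))
    [g.HasLeviCivita] (hg : g.IsRiemannian) (hR : ∀ x, 0 < g.scalarCurvature x)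
    (h12 : 1 / 4 * g.weylEnergy.toReal < g.sigma2WeylSchoutenIntegral) :
    ∃ (h : PseudoRiemannianMetric (𝓡 4) ∞ (EuclideanSpace ℝ (Fin 4)) (TangentSpace (𝓡 4) : M → Type _))
      (_ : h.HasLeviCivita) (hh : h.IsRiemannian),
      IsConformalTo (h.toContMDiffRiemannianMetric hh) (g.toContMDiffRiemannianMetric hg) ∧
      (∀ x, 0 < h.scalarCurvature x) ∧ ∀ x, 1 / 4 * h.weylNormSq x < h.sigma2WeylSchouten x := by
  have hκ : 0 < kappa g := (kappa_pos_iff g).2 h12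
  -- the start `δ`, the right side `q := P_δ(g)`, and `δ ∈ 𝒮` (PROVED in the tree)
  obtain ⟨δ, hδ1, hqs, hqpos⟩ := exists_pathOperator_pos g hg hR
  set q : M → ℝ := fun x ↦ pathOperator g δ x with hq
  set S : Set ℝ := {t | Solvable g t q} with hS
  have hδS : δ ∈ S := ⟨g, ‹g.HasLeviCivita›, fun _ ↦ 0, isPathSolution_self g hg hR δ⟩
  -- the uniform bound, with `κ₀ := κ(g)`, valid for every solution since `κ(h) = κ(g)` (tree)
  obtain ⟨C, hC⟩ := hApr M g hg q δ (kappa g) hqs hqpos hδ1 hκ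
  have hbound : ∀ t : ℝ, δ ≤ t → t ≤ 1 →
      ∀ (h : PseudoRiemannianMetric (𝓡 4) ∞ (EuclideanSpace ℝ (Fin 4)) (TangentSpace (𝓡 4) : M → Type _))
        [h.HasLeviCivita] (u : M → ℝ), IsPathSolution g h u t q →
        ∀ x, |u x| ≤ C ∧ g.gradSq u x ≤ C ∧ g.normSq x (g.hessian u x) ≤ C :=
    fun t hδt ht1 h _ u hsol ↦ hC t hδt ht1 h u hsol (IsPathSolution.kappa_eq g h hsol).ge
  -- `𝒮 ∩ [δ, 1]` is closed
  have hclosed : IsClosed (S ∩ Icc δ 1) := by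
    refine IsSeqClosed.isClosed fun s t hs hst ↦ ?_
    have hsδ : ∀ k, δ ≤ s k := fun k ↦ (hs k).2.1
    have hs1 : ∀ k, s k ≤ 1 := fun k ↦ (hs k).2.2
    refine ⟨?_, ge_of_tendsto' hst hsδ, le_of_tendsto' hst hs1⟩
    refine hClosed M g hg q C hqs hqpos s t hst hs1 fun k ↦ ?_
    obtain ⟨h, hLC, u, hsol⟩ := (hs k).1
    exact ⟨h, hLC, u, hsol, hbound (s k) (hsδ k) (hs1 k) h u hsol⟩
  -- openness + the continuity-method lemma: `1 ∈ 𝒮`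
  have h1S : (1 : ℝ) ∈ S := by
    refine hclosed.mem_of_ge_of_forall_exists_gt hδS hδ1 fun x hx ↦ ?_
    obtain ⟨hxS, -, hx1⟩ := hx
    obtain ⟨ε, hε, hε'⟩ := hOpen M g hg q hqs hqpos x hx1.le hxS
    refine ⟨min (x + ε / 2) 1, hε' _ ?_ ?_ (min_le_right _ _), lt_min (by linarith) hx1,
      min_le_right _ _⟩
    · have : x < min (x + ε / 2) 1 := lt_min (by linarith) hx1
      linarith
    · exact (min_le_left _ _).trans_lt (by linarith)
  -- the solution at `t = 1` is the conformal metric sought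
  obtain ⟨h, hLC, u, hh, hu, hconf, hRh, heq⟩ := h1S
  refine ⟨h, hLC, hh, ?_, hRh, fun x ↦ ?_⟩
  · exact ⟨fun x ↦ Real.exp (-2 * u x), fun x ↦ ⟨Real.exp_pos _, fun v w ↦ by
      simp only [toContMDiffRiemannianMetric_inner, hconf x v w]⟩⟩
  · have hx := heq x
    have hqx : 0 < q x * Real.exp (8 * u x) := mul_pos (hqpos x) (Real.exp_pos _)
    simp only [pathOperator] at hx
    nlinarith [hx, hqx]

end Composition

/-- **THE COMPOSITION IN HYPOTHESIS FORM (sorry-free kernel certificate of the glue)** — the crux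
`EntropyRung.ChangGurskyYang` from the six stub STATEMENTS as hypotheses (CGY 2003 §2, p. 121, line by
line): `(0.3) ⇒ (1.2)` by Chern–Gauss–Bonnet (THEOREM `chernGaussBonnet_four_holds`) and `χ(M) ≥ 2` for
closed simply connected `M` (`quarter_weylEnergy_lt_of_chernGaussBonnet`, PROVED); Thm. 1.4 in the
connected psc shape by the weighted Gursky–Viaclovsky path (`thm14Psc_of` over `pathApriori_of`) gives a
conformal metric with `R > 0` and `¼|W|² < σ₂(A)` pointwise; "rearranging terms"
(`weakPinching_lt_of_sigma2WeylSchouten_gt`, PROVED) gives `WP < 1/6`; Margerin's leaf (`margerin_of`)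
gives `S⁴ ∨ ℝP⁴`; `π₁ = 1` discards `ℝP⁴` (`IsRealProjectiveSpace.not_simplyConnectedSpace`, PROVED).
[cite: ChangGurskyYang2003, §2, p. 121] [cite: GurskyViaclovsky2003, §5] [cite: Margerin1998, Thm. 1] -/
theorem ChangGurskyYang_of_hypotheses
    (h₁ : ∀ (M : Type) [TopologicalSpace M] [T2Space M] [SecondCountableTopology M]
      [ChartedSpace (EuclideanSpace ℝ (Fin 4)) M] [IsManifold (𝓡 4) ∞ M] [CompactSpace M]
      [ConnectedSpace M]
      (g₀ : PseudoRiemannianMetric (𝓡 4) ∞ (EuclideanSpace ℝ (Fin 4)) (TangentSpace (𝓡 4) : M → Type _))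
      (m c K τ : ℝ), g₀.IsRiemannian → 0 < m → 0 < c → c < 1 / 6 → 0 < K → 0 < τ → τ ≤ 1 →
      (∀ (cov : CovariantDerivative (𝓡 4) (EuclideanSpace ℝ (Fin 4)) (TangentSpace (𝓡 4) : M → Type _)),
        g₀.IsLeviCivita cov →
        ∀ (x : M) (e : Fin 4 → TangentSpace (𝓡 4) x), g₀.IsOrthonormalFrame x e →
          (g₀.blockA cov x e, g₀.blockB cov x e, g₀.blockC cov x e) ∈ pinchingSet m c K τ) →
      (∀ (T : ℝ)
        (g : ℝ → PseudoRiemannianMetric (𝓡 4) ∞ (EuclideanSpace ℝ (Fin 4))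
          (TangentSpace (𝓡 4) : M → Type _))
        (cov : ℝ → CovariantDerivative (𝓡 4) (EuclideanSpace ℝ (Fin 4))
          (TangentSpace (𝓡 4) : M → Type _)),
        IsRicciFlow g cov (Ico 0 T) → (∀ t ∈ Ico 0 T, (g t).IsRiemannian) → g 0 = g₀ →
        ∀ t ∈ Ico 0 T, ∀ (x : M) (e : Fin 4 → TangentSpace (𝓡 4) x),
          (g t).IsOrthonormalFrame x e →
            ((g t).blockA (cov t) x e, (g t).blockB (cov t) x e, (g t).blockC (cov t) x e) ∈
              pinchingSet m c K τ) →
      ∃ (k : ℝ) (g' : PseudoRiemannianMetric (𝓡 4) ∞ (EuclideanSpace ℝ (Fin 4))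
          (TangentSpace (𝓡 4) : M → Type _)),
        0 < k ∧ g'.IsRiemannian ∧ g'.HasConstantSectionalCurvature k)
    (h₂ : ∀ (M : Type) [TopologicalSpace M] [T2Space M] [SecondCountableTopology M]
      [ChartedSpace (EuclideanSpace ℝ (Fin 4)) M] [IsManifold (𝓡 4) ∞ M] [CompactSpace M]
      (g : PseudoRiemannianMetric (𝓡 4) ∞ (EuclideanSpace ℝ (Fin 4)) (TangentSpace (𝓡 4) : M → Type _))
      [g.HasLeviCivita], g.IsRiemannian →
      ∀ (q : M → ℝ) (δ C₀ : ℝ), ContMDiff (𝓡 4) 𝓘(ℝ) ∞ q → (∀ x, 0 < q x) → δ ≤ 1 →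
      ∃ C₁ : ℝ, ∀ t : ℝ, δ ≤ t → t ≤ 1 →
        ∀ (h : PseudoRiemannianMetric (𝓡 4) ∞ (EuclideanSpace ℝ (Fin 4)) (TangentSpace (𝓡 4) : M → Type _))
          [h.HasLeviCivita] (u : M → ℝ), IsPathSolution g h u t q → (∀ x, u x ≤ C₀) →
          ∀ x, g.gradSq u x ≤ C₁)
    (h₃ : ∀ (M : Type) [TopologicalSpace M] [T2Space M] [SecondCountableTopology M]
      [ChartedSpace (EuclideanSpace ℝ (Fin 4)) M] [IsManifold (𝓡 4) ∞ M] [CompactSpace M]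
      [ConnectedSpace M]
      (g : PseudoRiemannianMetric (𝓡 4) ∞ (EuclideanSpace ℝ (Fin 4)) (TangentSpace (𝓡 4) : M → Type _)),
      g.IsRiemannian → ∀ C₁ : ℝ, ∃ C₂ : ℝ, ∀ u : M → ℝ, ContMDiff (𝓡 4) 𝓘(ℝ) ∞ u →
        (∀ x, g.gradSq u x ≤ C₁) → ∀ x y, u x ≤ u y + C₂)
    (h₄ : ∀ (M : Type) [TopologicalSpace M] [T2Space M] [SecondCountableTopology M]
      [ChartedSpace (EuclideanSpace ℝ (Fin 4)) M] [IsManifold (𝓡 4) ∞ M] [CompactSpace M]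
      (g : PseudoRiemannianMetric (𝓡 4) ∞ (EuclideanSpace ℝ (Fin 4)) (TangentSpace (𝓡 4) : M → Type _))
      [g.HasLeviCivita], g.IsRiemannian →
      ∀ (q : M → ℝ) (δ C₀ C₁ : ℝ), ContMDiff (𝓡 4) 𝓘(ℝ) ∞ q → (∀ x, 0 < q x) → δ ≤ 1 →
      ∃ C₂ : ℝ, ∀ t : ℝ, δ ≤ t → t ≤ 1 →
        ∀ (h : PseudoRiemannianMetric (𝓡 4) ∞ (EuclideanSpace ℝ (Fin 4)) (TangentSpace (𝓡 4) : M → Type _))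
          [h.HasLeviCivita] (u : M → ℝ), IsPathSolution g h u t q →
          (∀ x, |u x| ≤ C₀) → (∀ x, g.gradSq u x ≤ C₁) →
          ∀ x, g.normSq x (g.hessian u x) ≤ C₂)
    (h₅ : ∀ (M : Type) [TopologicalSpace M] [T2Space M] [SecondCountableTopology M]
      [ChartedSpace (EuclideanSpace ℝ (Fin 4)) M] [IsManifold (𝓡 4) ∞ M] [CompactSpace M]
      [ConnectedSpace M]
      (g : PseudoRiemannianMetric (𝓡 4) ∞ (EuclideanSpace ℝ (Fin 4)) (TangentSpace (𝓡 4) : M → Type _))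
      [g.HasLeviCivita], g.IsRiemannian →
      ∀ (q : M → ℝ), ContMDiff (𝓡 4) 𝓘(ℝ) ∞ q → (∀ x, 0 < q x) →
      ∀ t₀ : ℝ, t₀ ≤ 1 → Solvable g t₀ q →
        ∃ ε : ℝ, 0 < ε ∧ ∀ t : ℝ, t₀ - ε < t → t < t₀ + ε → t ≤ 1 → Solvable g t q)
    (h₆ : ∀ (M : Type) [TopologicalSpace M] [T2Space M] [SecondCountableTopology M]
      [ChartedSpace (EuclideanSpace ℝ (Fin 4)) M] [IsManifold (𝓡 4) ∞ M] [CompactSpace M]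
      [ConnectedSpace M]
      (g : PseudoRiemannianMetric (𝓡 4) ∞ (EuclideanSpace ℝ (Fin 4)) (TangentSpace (𝓡 4) : M → Type _))
      [g.HasLeviCivita], g.IsRiemannian →
      ∀ (q : M → ℝ) (C : ℝ), ContMDiff (𝓡 4) 𝓘(ℝ) ∞ q → (∀ x, 0 < q x) →
      ∀ (s : ℕ → ℝ) (t : ℝ), Tendsto s atTop (𝓝 t) → (∀ k, s k ≤ 1) →
        (∀ k, ∃ (h : PseudoRiemannianMetric (𝓡 4) ∞ (EuclideanSpace ℝ (Fin 4)) (TangentSpace (𝓡 4) : M → Type _))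
          (_ : h.HasLeviCivita) (u : M → ℝ), IsPathSolution g h u (s k) q ∧
            ∀ x, |u x| ≤ C ∧ g.gradSq u x ≤ C ∧ g.normSq x (g.hessian u x) ≤ C) →
        Solvable g t q) :
    ChangGurskyYang := by
  rintro M _ _ _ _ _ _ _ ⟨g, _, hgR, hscal, hW⟩
  have hE : finrank ℝ (EuclideanSpace ℝ (Fin 4)) = 4 := finrank_euclideanSpace_fin
  -- (0.3) ⇒ (1.2): Chern–Gauss–Bonnet (THEOREM of the tree) and `χ(M) ≥ 2` (PROVED)
  have h12 : 1 / 4 * g.weylEnergy.toReal < g.sigma2WeylSchoutenIntegral :=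
    quarter_weylEnergy_lt_of_chernGaussBonnet g hgR (chernGaussBonnet_four_holds M g hgR) hW
  -- Thm. 1.4, connected psc shape, by the weighted GV path: `g'` conformal, `R > 0`, `¼|W|² < σ₂(A)`
  obtain ⟨g', _, hg'R, -, hscal', hpt⟩ :=
    thm14Psc_of (fun N _ _ _ _ _ _ _ g₁ _ hg₁ q δ κ₀ hq hq0 hδ hκ₀ ↦
      pathApriori_of h₂ h₃ h₄ g₁ hg₁ q δ κ₀ hq hq0 hδ hκ₀) h₅ h₆ g hgR hscal h12
  have hpos' : ∀ (x : M) (v : TangentSpace (𝓡 4) x), v ≠ 0 → 0 < g'.val x v v :=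
    fun x v hv ↦ hg'R x v hv
  -- "rearranging terms": `WP < 1/6` pointwise (PROVED)
  have hWP : ∀ x, g'.weakPinching x < 1 / 6 := fun x ↦
    g'.weakPinching_lt_of_sigma2WeylSchouten_gt (WithTop.coe_le_coe.mpr le_top) hE (hpos' x) (hpt x)
  -- Margerin's leaf (rails stubs 1–3 LANDED + the flow stub): `S⁴ ∨ ℝP⁴`; `π₁ = 1` excludes `ℝP⁴`
  rcases margerin_of h₁ M g' hg'R hscal' hWP with h | h
  · exact h
  · exact absurd ‹SimplyConnectedSpace M› (h.not_simplyConnectedSpace (by norm_num))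

/-- **THE SKELETON THEOREM — the crux `EntropyRung.ChangGurskyYang` BY NAME**, its proof calling the six
registered stubs through the sorry-free glue `ChangGurskyYang_of_hypotheses` (this term typechecks iff
every stub statement matches the corresponding hypothesis symbol for symbol; it inherits the stubs'
`sorry`s by design and closes the crux the moment they land). [cite: ChangGurskyYang2003, §2, p. 121]
[cite: GurskyViaclovsky2003, Thm. 1 and §5] [cite: Margerin1998, Thm. 1] -/
theorem ChangGurskyYang_of : ChangGurskyYang :=
  ChangGurskyYang_of_hypotheses stub_pinchedFlowConvergence stub_pathGradient stub_pathHarnack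
    stub_pathHessian stub_pathOpen stub_pathClosed

/-- **The same skeleton theorem for the item's OTHER route decl `WeylBudget.ChangGurskyYang`** (rank 9 of
route WeylBudget; the two route decls are the same proposition, `Iff.rfl` — Disproof §1
`weylBudget_crux_iff`). [cite: ChangGurskyYang2003, Thm. A] -/
theorem ChangGurskyYang_of_weylBudget :
    Summit.SmoothPoincare4.SmoothPoincare4.Theses.WeylBudget.ChangGurskyYang :=
  ChangGurskyYang_of

end Summit.SmoothPoincare4.SmoothPoincare4.Cruxes.ChangGurskyYang.GvContinuityPath

end
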